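import Mathlib
import Summits.Ventures.PercRepro2.SwOutHullSplit
import Summits.Ventures.PercRepro2.SwOutArmGTyped

/-!
# The hull split on the general doubly typed side (blind cell PercRepro2, night-4 g32, 2026-08-28;
proofs/NIGHT4-G32.md §3b)

The hull split of SwOutHullSplit for g7's general doubly typed side `gOutSide`: the configurations
of a class with `p` outside the hull of `h` are the classes of `U ∖ {p}` (`mem_gOutSide_sdiff_iff`),
so the rigid counting inequality on `gOutSide` of `(U, ξ)` follows from the inequality on every
class of `U ∖ {p}` together with the inequality on the part `{p ∈ hull(h)}` alone
(**`card_le_g_of_hullSplit`**) — the same fibre argument, the five conditions of the side being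
conditions on the configuration alone.
-/

namespace Summit.Ventures.PercRepro2

namespace LocRows

open Hull

variable {V : Type*} {E : Type*} [Fintype E] [DecidableEq E]

open scoped Classical

section HullSplitG

variable {ends : E → Sym2 V} {U : Set V} {ξ : Config E} {l h p : V}
  {𝓤 𝓓 𝓓'' : Set (Set V)} {X : Set V} {𝓤' : Set (Set V)}

/-- **The configurations of a general doubly typed class with `p` outside the hull of `h` are the
classes of `U ∖ {p}`** (the doubly typed conditions are conditions on the configuration alone). -/
theorem mem_gOutSide_sdiff_iff {ζ ζ₁ : Config E} (hζ₁ : ζ₁ ∈ outClass ends U h ξ) :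
    (ζ ∈ gOutSide ends l h 𝓤 𝓓 𝓓'' X 𝓤' U ξ ∧ p ∉ hull ends ζ h ∧
        outerOf ends U p ξ ζ = outerOf ends U p ξ ζ₁) ↔
      ζ ∈ gOutSide ends l h 𝓤 𝓓 𝓓'' X 𝓤' (U \ {p}) (outerOf ends U p ξ ζ₁) := by
  rw [mem_gOutSide, mem_gOutSide, mem_outClass, mem_outClass]
  constructor
  · rintro ⟨⟨hQ, hag, hhull⟩, hp, hkey⟩
    refine ⟨hQ, fun e he => ?_, fun x hx => ⟨hhull hx, fun hxp => hp (hxp ▸ hx)⟩⟩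
    rw [← hkey, outerOf_of_notMem he]
  · rintro ⟨hQ, hag', hhull'⟩
    have hp : p ∉ hull ends ζ h := fun hp => (hhull' hp).2 rfl
    refine ⟨⟨hQ, fun e he => ?_, fun x hx => (hhull' hx).1⟩, hp, ?_⟩
    · have he' : e ∉ touches ends (U \ {p}) := fun h' => he (mem_touches_of_mem_touches_sdiff h')
      rw [hag' e he', outerOf_of_notMem he']
      exact (mem_outClass.1 hζ₁).1 e he
    · funext e
      by_cases he : e ∈ touches ends (U \ {p})
      · rw [outerOf_of_mem he, outerOf_of_mem he]
      · rw [outerOf_of_notMem he, hag' e he]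

/-- **THE HULL SPLIT, GENERAL DOUBLY TYPED SIDE**: the rigid counting inequality on `gOutSide` of
`(U, ξ)` follows from the inequality on every class of `U ∖ {p}` (for the outside colourings
extending `ξ`) together with the inequality on the part `{p ∈ hull(h)}` alone. -/
theorem card_le_g_of_hullSplit
    (hsub : ∀ ξ' : Config E, (∀ e, e ∉ touches ends U → ξ' e = ξ e) →
      ∀ 𝓔 : Set (Set E), IsUpperSet 𝓔 →
        ((gOutSide ends l h 𝓤 𝓓 𝓓'' X 𝓤' (U \ {p}) ξ').filter fun ζ =>
            redEdges ends ζ h ∈ 𝓔).card ≤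
          ((gOutSide ends l h 𝓤 𝓓 𝓓'' X 𝓤' (U \ {p}) ξ').filter fun ζ =>
            blueEdges ends ζ h ∈ 𝓔).card)
    (hin : ∀ 𝓔 : Set (Set E), IsUpperSet 𝓔 →
      ((gOutSide ends l h 𝓤 𝓓 𝓓'' X 𝓤' U ξ).filter fun ζ =>
          p ∈ hull ends ζ h ∧ redEdges ends ζ h ∈ 𝓔).card ≤
        ((gOutSide ends l h 𝓤 𝓓 𝓓'' X 𝓤' U ξ).filter fun ζ =>
          p ∈ hull ends ζ h ∧ blueEdges ends ζ h ∈ 𝓔).card)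
    {𝓔 : Set (Set E)} (h𝓔 : IsUpperSet 𝓔) :
    ((gOutSide ends l h 𝓤 𝓓 𝓓'' X 𝓤' U ξ).filter fun ζ => redEdges ends ζ h ∈ 𝓔).card ≤
      ((gOutSide ends l h 𝓤 𝓓 𝓓'' X 𝓤' U ξ).filter fun ζ => blueEdges ends ζ h ∈ 𝓔).card := by
  have hsplit : ∀ P : Config E → Prop,
      ((gOutSide ends l h 𝓤 𝓓 𝓓'' X 𝓤' U ξ).filter fun ζ => P ζ).card =
        ((gOutSide ends l h 𝓤 𝓓 𝓓'' X 𝓤' U ξ).filter fun ζ => p ∈ hull ends ζ h ∧ P ζ).card +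
          ((gOutSide ends l h 𝓤 𝓓 𝓓'' X 𝓤' U ξ).filter fun ζ => p ∉ hull ends ζ h ∧ P ζ).card := by
    intro P
    rw [← Finset.card_filter_add_card_filter_not (s := (gOutSide ends l h 𝓤 𝓓 𝓓'' X 𝓤' U ξ).filter
      fun ζ => P ζ) (p := fun ζ => p ∈ hull ends ζ h)]
    simp only [Finset.filter_filter]
    congr 1 <;> congr 1 <;> ext ζ <;> simp only [and_comm]
  rw [hsplit, hsplit]
  refine Nat.add_le_add (hin 𝓔 h𝓔) ?_
  let key : Config E → Config E := outerOf ends U p ξ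
  let S₀ : Finset (Config E) :=
    ((gOutSide ends l h 𝓤 𝓓 𝓓'' X 𝓤' U ξ).filter fun ζ => p ∉ hull ends ζ h).image key
  have hmap : ∀ (P : Config E → Prop) (ζ : Config E),
      ζ ∈ (gOutSide ends l h 𝓤 𝓓 𝓓'' X 𝓤' U ξ).filter (fun ζ => p ∉ hull ends ζ h ∧ P ζ) →
        key ζ ∈ S₀ := by
    intro P ζ hζ
    rw [Finset.mem_filter] at hζ
    exact Finset.mem_image_of_mem key (Finset.mem_filter.2 ⟨hζ.1, hζ.2.1⟩)
  rw [Finset.card_eq_sum_card_fiberwise (hmap _), Finset.card_eq_sum_card_fiberwise (hmap _)]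
  refine Finset.sum_le_sum fun k hk => ?_
  obtain ⟨ζ₁, hζ₁, rfl⟩ := Finset.mem_image.1 hk
  have hcl₁ : ζ₁ ∈ outClass ends U h ξ := (mem_gOutSide.1 (Finset.mem_filter.1 hζ₁).1).2
  have hfib : ∀ P : Config E → Prop,
      ((gOutSide ends l h 𝓤 𝓓 𝓓'' X 𝓤' U ξ).filter (fun ζ => p ∉ hull ends ζ h ∧ P ζ)).filter
          (fun ζ => key ζ = key ζ₁) =
        (gOutSide ends l h 𝓤 𝓓 𝓓'' X 𝓤' (U \ {p}) (outerOf ends U p ξ ζ₁)).filter fun ζ => P ζ := by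
    intro P
    ext ζ
    simp only [Finset.mem_filter]
    constructor
    · rintro ⟨⟨hζ, hp, hP⟩, hkey⟩
      exact ⟨(mem_gOutSide_sdiff_iff hcl₁).1 ⟨hζ, hp, hkey⟩, hP⟩
    · rintro ⟨hζ, hP⟩
      obtain ⟨hζ', hp, hkey⟩ := (mem_gOutSide_sdiff_iff (l := l) (𝓤 := 𝓤) (𝓓 := 𝓓) (𝓓'' := 𝓓'')
        (X := X) (𝓤' := 𝓤') hcl₁).2 hζ
      exact ⟨⟨hζ', hp, hP⟩, hkey⟩
  rw [hfib, hfib]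
  exact hsub (outerOf ends U p ξ ζ₁) (outerOf_agree hcl₁) 𝓔 h𝓔

end HullSplitG

end LocRows

end Summit.Ventures.PercRepro2
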